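import Mathlib
import Literature.MathematicalPhysics.QuantumLattice.TorusBlockTranslates

/-!
# Summing the block hopping terms over all translates: `Σ_a h_a = R(R-1) · H_hop`

Topic `MathematicalPhysics/QuantumLattice` (family `hubbard`); continuation of
`TorusBlockTranslates.lean`. For a block side `R ≤ L`, a corner `a ∈ (ℤ/Lℤ)²` and a spin `σ`, the
INNER hopping term of the block `a + [0,R)²` is written (as in the block-mode expansions of the
local kinetic budget) as the double sum over offsets
`Σ_{u,v ∈ [0,R)²} A(u,v) · c†_{a+u,σ} c_{a+v,σ}`, `A(u,v) = Σ_{e ∈ unitSteps} [v = u + e]`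
(integer coordinates). We prove:

* `sum_sum_adjacencyStep_smul_eq` — collapsing the `v`-sum: the block term equals
  `Σ_u Σ_{e ∈ unitSteps} [u + e ∈ [0,R)²] c†_{a+u,σ} c_{a+u+e,σ}`;
* `sum_corner_blockHopping_eq` — **summed over all `L²` corners, every bond of the torus is counted
  `R(R-1)` times**:
  `Σ_a Σ_{u,v} A(u,v) c†_{a+u,σ}c_{a+v,σ} = R(R-1) · Σ_x Σ_{e ∈ unitSteps} c†_{xσ} c_{x+e,σ}`,
  the right-hand side being the hopping term of `hubbardTorus` in unit-step form;
* `sum_corner_blockNumber_eq` — and every site `R²` times: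
  `Σ_a Σ_u n_{a+u,σ} = R² · Σ_x n_{xσ}`.

Folklore bookkeeping (Ruelle 1969 §2.2); no definition and no named fact is introduced.
-/

namespace Literature.MathematicalPhysics.QuantumLattice

open Finset Literature.Probability.LatticeModels

noncomputable section

variable {L : ℕ} [NeZero L]

omit [NeZero L] in
/-- If `v = u + e` in integer coordinates then the block sites satisfy `a + v = (a + u) + e` on the
torus. [folklore] -/
theorem blockSite_eq_add_proj (a : TorusSite 2 L) {R : ℕ} {u v : Fin 2 → Fin R} {e : Site 2}
    (h : ∀ i, ((v i : ℕ) : ℤ) = ((u i : ℕ) : ℤ) + e i) :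
    (a + fun i => ((v i : ℕ) : ZMod L)) = (a + fun i => ((u i : ℕ) : ZMod L)) + Torus.proj L e := by
  funext i
  simp only [Pi.add_apply, Torus.proj_apply]
  have h1 : (((v i : ℕ) : ℤ) : ZMod L) = (((u i : ℕ) : ℤ) : ZMod L) + ((e i : ℤ) : ZMod L) := by
    rw [h i, Int.cast_add]
  push_cast at h1
  rw [h1, add_assoc]

/-- The step label of an inner pair is unique: `v = u + e` and `w = u + e` force `v = w`. [folklore] -/
theorem eq_of_translate_eq {R : ℕ} {u v w : Fin 2 → Fin R} {e : Site 2}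
    (hv : ∀ i, ((v i : ℕ) : ℤ) = ((u i : ℕ) : ℤ) + e i) (hw : ∀ i, ((w i : ℕ) : ℤ) = ((u i : ℕ) : ℤ) + e i) :
    v = w :=
  funext fun i => Fin.ext (by exact_mod_cast (hv i).trans (hw i).symm)

omit [NeZero L] in
/-- **Collapsing the offset sum.** With `A(u,v) = Σ_{e ∈ unitSteps} [v = u + e]`,
`Σ_{u,v} A(u,v) · T(a+u, a+v) = Σ_u Σ_{e ∈ unitSteps} [∃ v, v = u + e] T(a+u, a+u+e)` for any
`T` on pairs of torus sites. [folklore] -/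
theorem sum_sum_adjacencyStep_smul_eq {M : Type*} [AddCommGroup M] [Module ℂ M] (a : TorusSite 2 L)
    (R : ℕ) (T : TorusSite 2 L → TorusSite 2 L → M) :
    ∑ u : Fin 2 → Fin R, ∑ v : Fin 2 → Fin R,
        (((∑ e ∈ unitSteps, if (∀ i, ((v i : ℕ) : ℤ) = ((u i : ℕ) : ℤ) + e i) then (1 : ℝ) else 0
          : ℝ) : ℂ)) • T (a + fun i => ((u i : ℕ) : ZMod L)) (a + fun i => ((v i : ℕ) : ZMod L)) =
      ∑ u : Fin 2 → Fin R, ∑ e ∈ unitSteps,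
        (if (∃ v : Fin 2 → Fin R, ∀ i, ((v i : ℕ) : ℤ) = ((u i : ℕ) : ℤ) + e i) then
          T (a + fun i => ((u i : ℕ) : ZMod L)) ((a + fun i => ((u i : ℕ) : ZMod L)) + Torus.proj L e)
        else 0) := by
  classical
  refine Finset.sum_congr rfl fun u _ => ?_
  -- expand the coefficient and swap the `v`- and `e`-sums
  have hcoef : ∀ v : Fin 2 → Fin R,
      (((∑ e ∈ unitSteps, if (∀ i, ((v i : ℕ) : ℤ) = ((u i : ℕ) : ℤ) + e i) then (1 : ℝ) else 0
          : ℝ) : ℂ)) • T (a + fun i => ((u i : ℕ) : ZMod L)) (a + fun i => ((v i : ℕ) : ZMod L)) =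
      ∑ e ∈ unitSteps, (if (∀ i, ((v i : ℕ) : ℤ) = ((u i : ℕ) : ℤ) + e i) then
        T (a + fun i => ((u i : ℕ) : ZMod L)) (a + fun i => ((v i : ℕ) : ZMod L)) else 0) := by
    intro v
    push_cast
    rw [Finset.sum_smul]
    refine Finset.sum_congr rfl fun e _ => ?_
    split_ifs <;> simp
  simp_rw [hcoef]
  rw [Finset.sum_comm]
  refine Finset.sum_congr rfl fun e _ => ?_
  by_cases hex : ∃ v : Fin 2 → Fin R, ∀ i, ((v i : ℕ) : ℤ) = ((u i : ℕ) : ℤ) + e i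
  · obtain ⟨v₀, hv₀⟩ := hex
    rw [if_pos ⟨v₀, hv₀⟩, Finset.sum_eq_single v₀, if_pos hv₀, blockSite_eq_add_proj a hv₀]
    · intro v _ hv
      exact if_neg fun h => hv (eq_of_translate_eq h hv₀)
    · exact fun h => absurd (Finset.mem_univ _) h
  · rw [if_neg hex]
    exact Finset.sum_eq_zero fun v _ => if_neg fun h => hex ⟨v, h⟩

/-- **`Σ_a h_a = R(R-1) · H_hop`**: summed over all corners, the inner hopping terms of the blocks
count every bond of the torus `R(R-1)` times. [folklore] -/
theorem sum_corner_blockHopping_eq (R : ℕ) (σ : Fin 2) :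
    ∑ a : TorusSite 2 L, ∑ u : Fin 2 → Fin R, ∑ v : Fin 2 → Fin R,
        (((∑ e ∈ unitSteps, if (∀ i, ((v i : ℕ) : ℤ) = ((u i : ℕ) : ℤ) + e i) then (1 : ℝ) else 0
          : ℝ) : ℂ)) •
          (creation (orb (FermionTorus.ofTorusSite (a + fun i => ((u i : ℕ) : ZMod L))) σ) *
            annihilation (orb (FermionTorus.ofTorusSite (a + fun i => ((v i : ℕ) : ZMod L))) σ) :
              Matrix (Finset (Orb (FermionTorus 2 L))) (Finset (Orb (FermionTorus 2 L))) ℂ) =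
      (R * (R - 1)) • ∑ x : TorusSite 2 L, ∑ e ∈ unitSteps,
        creation (orb (FermionTorus.ofTorusSite x) σ) *
          annihilation (orb (FermionTorus.ofTorusSite (x + Torus.proj L e)) σ) := by
  classical
  have h1 := fun a : TorusSite 2 L => sum_sum_adjacencyStep_smul_eq a R
    (fun x y : TorusSite 2 L => (creation (orb (FermionTorus.ofTorusSite x) σ) *
      annihilation (orb (FermionTorus.ofTorusSite y) σ) :
        Matrix (Finset (Orb (FermionTorus 2 L))) (Finset (Orb (FermionTorus 2 L))) ℂ))
  simp only [h1]
  -- swap to `Σ_e Σ_a Σ_u` and count translates step by step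
  conv_rhs => rw [Finset.sum_comm]
  rw [Finset.smul_sum]
  simp_rw [Finset.sum_comm (s := (Finset.univ : Finset (Fin 2 → Fin R))) (t := unitSteps)]
  rw [Finset.sum_comm]
  refine Finset.sum_congr rfl fun e he => ?_
  rw [sum_sum_ite_exists_translate R he (fun x : TorusSite 2 L =>
    (creation (orb (FermionTorus.ofTorusSite x) σ) *
      annihilation (orb (FermionTorus.ofTorusSite (x + Torus.proj L e)) σ) :
        Matrix (Finset (Orb (FermionTorus 2 L))) (Finset (Orb (FermionTorus 2 L))) ℂ))]

/-- **`Σ_a N_a^σ = R² · N^σ`**: summed over all corners, the block number operators count every site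
`R²` times. [folklore] -/
theorem sum_corner_blockNumber_eq (R : ℕ) (σ : Fin 2) :
    ∑ a : TorusSite 2 L, ∑ u : Fin 2 → Fin R,
        (numberOp (FermionTorus.ofTorusSite (a + fun i => ((u i : ℕ) : ZMod L))) σ :
          Matrix (Finset (Orb (FermionTorus 2 L))) (Finset (Orb (FermionTorus 2 L))) ℂ) =
      (R ^ 2) • ∑ x : TorusSite 2 L, numberOp (FermionTorus.ofTorusSite x) σ :=
  sum_sum_translate R fun x => (numberOp (FermionTorus.ofTorusSite x) σ :
    Matrix (Finset (Orb (FermionTorus 2 L))) (Finset (Orb (FermionTorus 2 L))) ℂ)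

end

end Literature.MathematicalPhysics.QuantumLattice
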